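import Mathlib
import Summits.Ventures.PercRepro2.ExistsChordRootEdge

/-!
# (EXISTS-CHORD) narrowed: the hypothesis of record is needed only where every edge from `a₃` to a
root is `0` or `1` (blind cell PercRepro2, night-1 g18; NIGHT1-G18.md §2″)

`RootEdge.existsChord_of_root_edge` / `_root2_edge` discharge `Chord.ExistsChord` at every weight
vector with a fractional edge from `a₃` to a root.  Folding this into mine-a's induction
(`Chord.HCov_of_existsChord`):

* `NoFracRootEdgeAtA3 p`: every edge `{a₃, a₁}`, `{a₃, a₂}` has weight `0` or `1`;
* **`HCov_of_existsChord_narrowed`**: (EXISTS-CHORD) at the vectors with `NoFracRootEdgeAtA3`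
  gives (HCOV) at every admissible vector of the instance;
* **`ExistsChordNarrowed_all`**, **`HCov_all_of_existsChordNarrowed_all`**: the narrowed row over
  all instances implies the crux of record `CovForm.HCov_all`.

Own code; standard axioms.
-/

namespace Summit.Ventures.PercRepro2

open UnionCluster CovForm

namespace RootEdge

section Narrowed

variable {V : Type*} {E : Type*} [Fintype E] [DecidableEq E] [Fintype V] [DecidableEq V]
  {R : Type*} [Field R] [LinearOrder R] [IsStrictOrderedRing R]

variable (ends : E → Sym2 V) (a₁ a₂ a₃ : V)

/-- Every edge from `a₃` to a root has weight `0` or `1`. -/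
def NoFracRootEdgeAtA3 (p : E → R) : Prop :=
  ∀ e, (ends e = s(a₃, a₁) ∨ ends e = s(a₃, a₂)) → p e = 0 ∨ p e = 1

variable {ends a₁ a₂ a₃}

/-- (EXISTS-CHORD) at `p` from the narrowed hypothesis: either some `a₃`–root edge is fractional
(the theorem) or none is (the hypothesis). -/
theorem existsChord_of_narrowed (p : E → R) (hp : IsProbVec p) (o b : V)
    (h : NoFracRootEdgeAtA3 ends a₁ a₂ a₃ p → Chord.ExistsChord p ends o a₁ a₂ a₃ b) :
    Chord.ExistsChord p ends o a₁ a₂ a₃ b := by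
  by_cases hno : NoFracRootEdgeAtA3 ends a₁ a₂ a₃ p
  · exact h hno
  · unfold NoFracRootEdgeAtA3 at hno
    push Not at hno
    obtain ⟨f, hf, hf0, hf1⟩ := hno
    rcases hf with hf | hf
    · exact existsChord_of_root_edge p ends o b hp hf ⟨hf0, hf1⟩
    · exact existsChord_of_root2_edge p ends o b hp hf ⟨hf0, hf1⟩

/-- **(HCOV) from (EXISTS-CHORD) at the vectors with no fractional `a₃`–root edge** (mine-a's
induction with the root-edge class theorem folded in). -/
theorem HCov_of_existsChord_narrowed (o b : V)
    (hex : ∀ q : E → R, IsProbVec q → NoFracRootEdgeAtA3 ends a₁ a₂ a₃ q →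
      Chord.ExistsChord q ends o a₁ a₂ a₃ b)
    (p : E → R) (hp : IsProbVec p) : HCov p ends o a₁ a₂ a₃ b :=
  Chord.HCov_of_existsChord ends o a₁ a₂ a₃ b
    (fun q hq => existsChord_of_narrowed q hq o b (hex q hq)) p hp

end Narrowed

section Closure

variable (R : Type*) [Field R] [LinearOrder R] [IsStrictOrderedRing R]

/-- **The narrowed row (EXISTS-CHORD)**: only at vectors whose edges from `a₃` to the roots are all
`0` or `1`. -/
def ExistsChordNarrowed_all : Prop :=
  ∀ (V E : Type) [Fintype V] [DecidableEq V] [Fintype E] [DecidableEq E]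
    (ends : E → Sym2 V) (p : E → R), IsProbVec p →
    ∀ o a₁ a₂ a₃ b : V, a₁ ≠ a₂ → a₁ ≠ a₃ → a₂ ≠ a₃ → o ≠ a₁ → o ≠ a₂ → o ≠ a₃ → o ≠ b →
      b ≠ a₁ → b ≠ a₂ → b ≠ a₃ → NoFracRootEdgeAtA3 ends a₁ a₂ a₃ p →
        Chord.ExistsChord p ends o a₁ a₂ a₃ b

/-- **The crux of record from the narrowed row.** -/
theorem HCov_all_of_existsChordNarrowed_all (h : ExistsChordNarrowed_all R) : HCov_all R := by
  intro V E _ _ _ _ ends p hp o a₁ a₂ a₃ b h12 h13 h23 ho1 ho2 ho3 hob hb1 hb2 hb3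
  exact HCov_of_existsChord_narrowed o b
    (fun q hq hno => h V E ends q hq o a₁ a₂ a₃ b h12 h13 h23 ho1 ho2 ho3 hob hb1 hb2 hb3 hno) p hp

end Closure

end RootEdge

end Summit.Ventures.PercRepro2
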